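import Summits.CriticalPhenomena.PercolationContinuityZ3.Theorems.Transplant.PlanarSkeletonConcDefs
import Summits.CriticalPhenomena.PercolationContinuityZ3.Theorems.Transplant.HeisenbergZCylSubcritical
import HarnessLib

/-!
# `H₃(ℤ) × ℤ` carries the design-(D) interface `PlanarSkeletonConc` (degree `6`, outward steps, connected cylinders `ℓ ≥ 1`);
# `θ_{H₃(ℤ)×ℤ}(p_c) = 0` from the (D)-form node of record `SamePDropOfSkeletonConcLt` with NO further residue

builds on p205010 (kernel theorem, internal audit signed; external expert review pending) — nothing in this file uses p205010.
Status sentence (coordinator 2026-08-20T04:30Z): "θ(p_c) = 0 on ℤ^d, all d ≥ 2 — kernel-verified (Lean 4/Mathlib, standard axioms);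
internal adversarial audit SIGNED 2026-08-20 04:29Z; external expert review pending."

Lane `prim-bschramm`, seat `prim-bschramm-p4` (gen 5; class map, memo `P4-GENERAL.md` §13), helper file
(`--supports stmt-CriticalPhenomena-4575`).  Second INSTANCE of `PlanarSkeletonConc` (stmt-g6, `PlanarSkeletonConcDefs.lean`; design of
record SHEAR-SCOPE §p3 / V83), for the Cayley graph of `H₃(ℤ) × ℤ` w.r.t. `A^{±1}, B^{±1}, T^{±1}` (`TransplantHeisenbergZ.lean`):
(μ) degree `≤ 6` (`hz_degree_le`: the neighbours are the six `v·s`), (ι) outward steps by `A^{±1}`, `B^{±1}` (`hz_step`: `hzAb` is a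
homomorphism to `ℤ²`), (κ) the cylinders `hzCyl ℓ = {|a|, |b| ≤ ℓ}` are connected for `ℓ ≥ 1` — ALREADY in the tree (p4 gen 2,
`hzCylGraph_connected`, `HeisenbergZCylinderSteering.lean`); the cylinder input Φ2 at `p_c` is also in the tree
(`heisenbergZCylSubcritical_holds`, p4 gen 2, via Martineau–Severo).  So on this rung the (D)-form node is the ONLY hypothesis:

* `hzSkeletonConc : PlanarSkeletonConc heisenbergZGraph` (extends `hzSkeleton`);
* `heisenbergZCriticalContinuity_of_skeletonConcNode : SamePDropOfSkeletonConcLt → HeisenbergZCriticalContinuity` (node of record, lead g3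
  17:54:17Z; `…_of_conc` from the binder-less `SamePDropOfSkeletonConc`).  Nothing is claimed about either node.
[cite: BenjaminiSchramm1996, Conj. 4] [cite: KozmaNitzan2024, §4 p. 15 (boxes); §1 p. 2 (approach 1)] [cite: MartineauSevero2019, Cor. 2.2]
-/

noncomputable section

namespace Summit.CriticalPhenomena.PercolationContinuityZ3.Theorems.Transplant

open MeasureTheory Literature.Probability.Percolation Literature.Probability.LatticeModels SimpleGraph
open Literature.Barriers.CriticalPhenomena (IsQuasiTransitive IsGraphAmenable)
open HeisenbergZ

/-! ## §1 Degree and outward steps -/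

/-- A graph whose neighbourhoods lie in explicit finite sets has the corresponding degree bound. [folklore] -/
theorem degree_le_card_of_neighborSet_subset {V : Type*} (G : SimpleGraph V) [G.LocallyFinite] (v : V) (S : Finset V)
    (h : G.neighborSet v ⊆ ↑S) : G.degree v ≤ S.card := by
  rw [← card_neighborFinset_eq_degree]
  refine Finset.card_le_card fun w hw => ?_
  exact h ((mem_neighborFinset _ _ _).1 hw)

/-- **(μ) for `H₃(ℤ) × ℤ`**: every vertex has degree `≤ 6`. [folklore] -/
theorem hz_degree_le (v : HZ) : heisenbergZGraph.degree v ≤ 6 := by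
  classical
  have h := degree_le_card_of_neighborSet_subset heisenbergZGraph v
    {hzMul v gA, hzMul v gB, hzMul v gT, hzMul v gAinv, hzMul v gBinv, hzMul v gTinv} (by
      intro y hy
      simpa only [Finset.coe_insert, Finset.coe_singleton] using neighborSet_subset v hy)
  refine h.trans ?_
  refine (Finset.card_insert_le _ _).trans (Nat.succ_le_succ ((Finset.card_insert_le _ _).trans (Nat.succ_le_succ
    ((Finset.card_insert_le _ _).trans (Nat.succ_le_succ ((Finset.card_insert_le _ _).trans (Nat.succ_le_succ
    ((Finset.card_insert_le _ _).trans (Nat.succ_le_succ ?_)))))))))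
  simp

/-- The abelianisation of the generators `A^{±1}`, `B^{±1}` is `±e₀`, `±e₁`. [folklore] -/
theorem hzAb_gens :
    hzAb gA = Pi.single (0 : Fin 2) (1 : ℤ) ∧ hzAb gAinv = Pi.single (0 : Fin 2) (-1 : ℤ) ∧
      hzAb gB = Pi.single (1 : Fin 2) (1 : ℤ) ∧ hzAb gBinv = Pi.single (1 : Fin 2) (-1 : ℤ) := by
  refine ⟨?_, ?_, ?_, ?_⟩ <;> ext j <;> fin_cases j <;> simp [hzAb, gA, gAinv, gB, gBinv]

/-- **(ι) for `H₃(ℤ) × ℤ`**: at every vertex the generators `A^{±1}`, `B^{±1}` move `hzAb = (a, b)` by `±e₀`, `±e₁`. [folklore] -/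
theorem hz_step (v : HZ) (i : Fin 2) (σ : ℤˣ) :
    ∃ v' : HZ, heisenbergZGraph.Adj v v' ∧ hzAb v' = hzAb v + Pi.single i (σ : ℤ) := by
  obtain ⟨hA, hAi, hB, hBi⟩ := hzAb_gens
  rcases Int.units_eq_one_or σ with rfl | rfl <;> fin_cases i
  · exact ⟨hzMul v gA, adj_mul_gen v (Or.inl rfl), by rw [hzAb_hzMul, hA]; rfl⟩
  · exact ⟨hzMul v gB, adj_mul_gen v (Or.inr (Or.inl rfl)), by rw [hzAb_hzMul, hB]; rfl⟩
  · exact ⟨hzMul v gAinv, adj_mul_gen v (Or.inr (Or.inr (Or.inr (Or.inl rfl)))), by rw [hzAb_hzMul, hAi]; rfl⟩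
  · exact ⟨hzMul v gBinv, adj_mul_gen v (Or.inr (Or.inr (Or.inr (Or.inr (Or.inl rfl))))), by rw [hzAb_hzMul, hBi]; rfl⟩

/-! ## §2 The instance and the rung -/

/-- **`H₃(ℤ) × ℤ` carries the design-(D) interface**: `hzSkeleton` + degree `6` + outward steps + connected cylinders (`ℓ ≥ 1`,
`hzCylGraph_connected`). [cite: KozmaNitzan2024, §4 p. 15] -/
def hzSkeletonConc : PlanarSkeletonConc heisenbergZGraph where
  toPlanarSkeleton := hzSkeleton
  Δ := 6
  degree_le := hz_degree_le
  step := hz_step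
  cyl_connected := by
    intro t ht ℓ hℓ
    have ht' : t = 0 := by simpa [hzSkeleton] using ht
    subst ht'
    have e : {w : HZ | hzSkeleton.φ w - hzSkeleton.φ 0 ∈ box 2 ℓ} = hzCyl ℓ := hzSkeleton_cyl ℓ
    rw [e]
    exact hzCylGraph_connected hℓ

/-- The underlying planar skeleton is `hzSkeleton`. [folklore] -/
@[simp] theorem hzSkeletonConc_toPlanarSkeleton : hzSkeletonConc.toPlanarSkeleton = hzSkeleton := rfl

/-- **`θ_{H₃(ℤ)×ℤ}(p_c) = 0` from the node of record `SamePDropOfSkeletonConcLt` ALONE** (the (D)-form drop node at densities `p < 1`;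
NOT proved, never asserted): connected, quasi-transitive, amenable (uniqueness by the tree's Burton–Keane), `p_c(H₃×ℤ) < 1`
(`criticalProb_heisenbergZ_lt_one`), interface `hzSkeletonConc`, cylinders at `p_c` by the tree's `heisenbergZCylSubcritical_holds`.
Conditional on the node only. [cite: BenjaminiSchramm1996, Conj. 4] [cite: KozmaNitzan2024, §1 p. 2 (approach 1)] -/
theorem heisenbergZCriticalContinuity_of_skeletonConcNode (hD : SamePDropOfSkeletonConcLt) : HeisenbergZCriticalContinuity := by
  unfold HeisenbergZCriticalContinuity
  refine continuity_of_skeletonConcLt_drop_amenable hD heisenbergZGraph hzSkeletonConc heisenbergZGraph_connected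
    heisenbergZGraph_quasiTransitive isGraphAmenable_heisenbergZ 0 (Finset.mem_singleton_self _) criticalProb_heisenbergZ_lt_one ?_
  rw [hzSkeletonConc_toPlanarSkeleton]
  exact hzSkeleton_cylSubcritical

/-- The same from the binder-less node `SamePDropOfSkeletonConc` (which implies the node of record). [folklore] -/
theorem heisenbergZCriticalContinuity_of_skeletonConcNode_of_conc (hD : SamePDropOfSkeletonConc) : HeisenbergZCriticalContinuity :=
  heisenbergZCriticalContinuity_of_skeletonConcNode (samePDropOfSkeletonConcLt_of_conc hD)

end Summit.CriticalPhenomena.PercolationContinuityZ3.Theorems.Transplant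

end
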